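import Summits.SmoothPoincare4.SmoothPoincare4.Theses.EntropyRung
import Summits.SmoothPoincare4.SmoothPoincare4.Theorems.EntropyRungSubcylindricalExistenceEntropyLocalisation
import Literature.Geometry.Riemannian.BakryEmeryHeatFlow
import Literature.Geometry.Riemannian.CanonicalNeighbourhoodScaling
import HarnessLib

/-!
# Propagation of a weighted `𝒲`-clause to all larger scales (helper H11)

Helper for the crux `SubcylindricalExistence` (ENT), route `EntropyRung`, line
`green-blowup-conformal-entropy`, Stub D (large scales). For a smooth weight `ψ > 0` (the conformal
factor of the glued metric `ψ² g`) and a continuous curvature weight `r`, the `w²`-form of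
Perelman's functional at scale `τ` is
`E(w, τ) = ∫ (τ (r w² + 4 ψ⁻² |∇w|²) − w² log w² − 4 w²) c ψ⁴ dV_g`, `c = (4πτ)⁻²`, on
`ψ`-normalised `w` (`∫ c w² ψ⁴ = 1`). **`largeScale_propagation`:** if the clause `E ≥ L` holds at
one scale `τ₀` and the quadratic part satisfies `∫ (r w² + 4ψ⁻²|∇w|²) c ψ⁴ ≥ a` at every scale,
with `a τ₀ ≥ 2`, then `E ≥ L` at every scale `τ ≥ τ₀`. Proof: the scaling identity
`E(w, τ) = E(w₀, τ₀) + (τ − τ₀) ∫ (r w² + 4ψ⁻²|∇w|²) c ψ⁴ + 2 log(τ₀/τ)` for `w₀ = (τ₀/τ) w`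
(normalised at `τ₀`), and `2 log(τ/τ₀) ≤ 2(τ − τ₀)/τ₀ ≤ a (τ − τ₀)`. (Perelman 2002, §3: the
`τ`-dependence of `𝒲`; elementary.)
-/

noncomputable section

open scoped Manifold ContDiff Topology ENNReal NNReal
open Set Filter MeasureTheory
open Literature.Geometry.Lorentzian Literature.Geometry.Riemannian

set_option linter.dupNamespace false

namespace Summit.SmoothPoincare4.SmoothPoincare4.Theorems

namespace LargeScale

/-- The elementary inequality behind the propagation: `2 log(τ/τ₀) ≤ a (τ − τ₀)` for
`τ ≥ τ₀ > 0` and `a τ₀ ≥ 2` (`log x ≤ x − 1`). -/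
theorem two_mul_log_div_le {a τ₀ τ : ℝ} (hτ₀ : 0 < τ₀) (haτ : 2 ≤ a * τ₀) (hτ : τ₀ ≤ τ) :
    2 * Real.log (τ / τ₀) ≤ a * (τ - τ₀) := by
  have h1 : Real.log (τ / τ₀) ≤ τ / τ₀ - 1 := Real.log_le_sub_one_of_pos (div_pos (hτ₀.trans_le hτ) hτ₀)
  have h2 : τ / τ₀ - 1 = (τ - τ₀) / τ₀ := by field_simp
  have h3 : 2 * ((τ - τ₀) / τ₀) ≤ a * (τ - τ₀) := by
    rw [mul_div_assoc', div_le_iff₀ hτ₀]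
    nlinarith [sub_nonneg.mpr hτ]
  linarith [h1, h2 ▸ h1]

variable {M : Type} [TopologicalSpace M] [ChartedSpace (EuclideanSpace ℝ (Fin 4)) M] [IsManifold (𝓡 4) ∞ M]
  (g : PseudoRiemannianMetric (𝓡 4) ∞ (EuclideanSpace ℝ (Fin 4)) (TangentSpace (𝓡 4) : M → Type _))

/-- The weighted density is continuous for smooth `w`, smooth positive `ψ` and continuous `r`. -/
theorem continuous_density {ψ r w : M → ℝ} (hψ : ContMDiff (𝓡 4) 𝓘(ℝ, ℝ) ∞ ψ) (hψpos : ∀ x, 0 < ψ x)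
    (hr : Continuous r) (hw : ContMDiff (𝓡 4) 𝓘(ℝ, ℝ) ∞ w) (t k : ℝ) :
    Continuous fun x ↦ (t * (r x * (w x) ^ 2 + 4 * ((ψ x)⁻¹ ^ 2 * g.gradSq w x))
      - (w x) ^ 2 * Real.log ((w x) ^ 2) - 4 * (w x) ^ 2) * (k * (ψ x) ^ 4) := by
  have hwc : Continuous w := hw.continuous
  have hψc : Continuous ψ := hψ.continuous
  have hG : Continuous (g.gradSq w) := (contMDiff_gradSq g hw).continuous
  have hinv : Continuous fun x ↦ (ψ x)⁻¹ := hψc.inv₀ fun x ↦ (hψpos x).ne'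
  have hlog : Continuous fun x ↦ (w x) ^ 2 * Real.log ((w x) ^ 2) := Real.continuous_mul_log.comp (hwc.pow 2)
  exact (((continuous_const.mul ((hr.mul (hwc.pow 2)).add (continuous_const.mul ((hinv.pow 2).mul hG)))).sub hlog).sub
    (continuous_const.mul (hwc.pow 2))).mul (continuous_const.mul (hψc.pow 4))

/-- The quadratic density is continuous. -/
theorem continuous_quadDensity {ψ r w : M → ℝ} (hψ : ContMDiff (𝓡 4) 𝓘(ℝ, ℝ) ∞ ψ) (hψpos : ∀ x, 0 < ψ x)
    (hr : Continuous r) (hw : ContMDiff (𝓡 4) 𝓘(ℝ, ℝ) ∞ w) (k : ℝ) :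
    Continuous fun x ↦ (r x * (w x) ^ 2 + 4 * ((ψ x)⁻¹ ^ 2 * g.gradSq w x)) * (k * (ψ x) ^ 4) := by
  have hwc : Continuous w := hw.continuous
  have hψc : Continuous ψ := hψ.continuous
  have hG : Continuous (g.gradSq w) := (contMDiff_gradSq g hw).continuous
  have hinv : Continuous fun x ↦ (ψ x)⁻¹ := hψc.inv₀ fun x ↦ (hψpos x).ne'
  exact ((hr.mul (hwc.pow 2)).add (continuous_const.mul ((hinv.pow 2).mul hG))).mul (continuous_const.mul (hψc.pow 4))

end LargeScale

open LargeScale in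
/-- **Helper H11 (registered stub `largeScale_propagation`) — the weighted clause propagates from
one scale to all larger scales** when the quadratic part is bounded below by `a` with `a τ₀ ≥ 2`.
See the module docstring. -/
theorem largeScale_propagation :
    ∀ (M : Type) [TopologicalSpace M] [T2Space M] [SecondCountableTopology M]
      [ChartedSpace (EuclideanSpace ℝ (Fin 4)) M] [IsManifold (𝓡 4) ∞ M] [CompactSpace M]
      [T3Space M] [MeasurableSpace M] [BorelSpace M]
      (g : PseudoRiemannianMetric (𝓡 4) ∞ (EuclideanSpace ℝ (Fin 4)) (TangentSpace (𝓡 4) : M → Type _))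
      [g.HasLeviCivita] (hg : g.IsRiemannian) (ψ r : M → ℝ), ContMDiff (𝓡 4) 𝓘(ℝ, ℝ) ∞ ψ → (∀ x, 0 < ψ x) →
      Continuous r → ∀ (L a τ₀ : ℝ), 0 < τ₀ → 0 < a → 2 ≤ a * τ₀ →
      (∀ w : M → ℝ, ContMDiff (𝓡 4) 𝓘(ℝ, ℝ) ∞ w →
        ∫ x, (4 * Real.pi * τ₀) ^ (-(4 : ℝ) / 2) * (w x) ^ 2 * (ψ x) ^ 4
            ∂(riemannianMeasure (g.toContMDiffRiemannianMetric hg)) = 1 →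
          L ≤ ∫ x, (τ₀ * (r x * (w x) ^ 2 + 4 * ((ψ x)⁻¹ ^ 2 * g.gradSq w x))
              - (w x) ^ 2 * Real.log ((w x) ^ 2) - 4 * (w x) ^ 2)
              * ((4 * Real.pi * τ₀) ^ (-(4 : ℝ) / 2) * (ψ x) ^ 4)
            ∂(riemannianMeasure (g.toContMDiffRiemannianMetric hg))) →
      (∀ τ : ℝ, 0 < τ → ∀ w : M → ℝ, ContMDiff (𝓡 4) 𝓘(ℝ, ℝ) ∞ w →
        ∫ x, (4 * Real.pi * τ) ^ (-(4 : ℝ) / 2) * (w x) ^ 2 * (ψ x) ^ 4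
            ∂(riemannianMeasure (g.toContMDiffRiemannianMetric hg)) = 1 →
          a ≤ ∫ x, (r x * (w x) ^ 2 + 4 * ((ψ x)⁻¹ ^ 2 * g.gradSq w x))
              * ((4 * Real.pi * τ) ^ (-(4 : ℝ) / 2) * (ψ x) ^ 4)
            ∂(riemannianMeasure (g.toContMDiffRiemannianMetric hg))) →
      ∀ τ : ℝ, τ₀ ≤ τ → ∀ w : M → ℝ, ContMDiff (𝓡 4) 𝓘(ℝ, ℝ) ∞ w →
        ∫ x, (4 * Real.pi * τ) ^ (-(4 : ℝ) / 2) * (w x) ^ 2 * (ψ x) ^ 4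
            ∂(riemannianMeasure (g.toContMDiffRiemannianMetric hg)) = 1 →
          L ≤ ∫ x, (τ * (r x * (w x) ^ 2 + 4 * ((ψ x)⁻¹ ^ 2 * g.gradSq w x))
              - (w x) ^ 2 * Real.log ((w x) ^ 2) - 4 * (w x) ^ 2)
              * ((4 * Real.pi * τ) ^ (-(4 : ℝ) / 2) * (ψ x) ^ 4)
            ∂(riemannianMeasure (g.toContMDiffRiemannianMetric hg))
 := by
  intro M _ _ _ _ _ _ _ _ _ g _ hg ψ r hψ hψpos hr L a τ₀ hτ₀ ha haτ hclause hquad τ hτ w hw hnorm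
  set μ : Measure M := riemannianMeasure (g.toContMDiffRiemannianMetric hg) with hμ
  have hτpos : 0 < τ := hτ₀.trans_le hτ
  set c : ℝ := (4 * Real.pi * τ) ^ (-(4 : ℝ) / 2) with hc
  set s : ℝ := τ₀ / τ with hs
  have hs0 : 0 < s := div_pos hτ₀ hτpos
  have hsτ : s * τ = τ₀ := by rw [hs]; field_simp
  have hc₀ : (4 * Real.pi * τ₀) ^ (-(4 : ℝ) / 2) = c / s ^ 2 := by
    -- `(4π s τ)^{-2} = (4πτ)^{-2}/s²` (as in `WeightComparison.normConst_rescale`)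
    have e1 : ∀ t : ℝ, 0 < t → (4 * Real.pi * t) ^ (-(4 : ℝ) / 2) = ((4 * Real.pi * t) ^ 2)⁻¹ := fun t ht ↦ by
      rw [show (-(4 : ℝ) / 2) = -(2 : ℝ) by norm_num, Real.rpow_neg (by positivity), Real.rpow_two]
    have hπ : (0 : ℝ) < Real.pi := Real.pi_pos
    rw [← hsτ, e1 _ (mul_pos hs0 hτpos), hc, e1 _ hτpos]
    field_simp
  -- the rescaled test function `w₀ = s w`, normalised at `τ₀`
  set w₀ : M → ℝ := fun x ↦ s * w x with hw₀
  have hw₀s : ContMDiff (𝓡 4) 𝓘(ℝ, ℝ) ∞ w₀ := contMDiff_const.mul hw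
  have hnorm₀ : ∫ x, (4 * Real.pi * τ₀) ^ (-(4 : ℝ) / 2) * (w₀ x) ^ 2 * (ψ x) ^ 4 ∂μ = 1 := by
    have h1 : ∀ x, (4 * Real.pi * τ₀) ^ (-(4 : ℝ) / 2) * (w₀ x) ^ 2 * (ψ x) ^ 4 = c * (w x) ^ 2 * (ψ x) ^ 4 := by
      intro x; rw [hc₀]; simp only [hw₀]; field_simp
    simp_rw [h1]; exact hnorm
  have hL := hclause w₀ hw₀s hnorm₀
  have hq := hquad τ hτpos w hw hnorm
  rw [hc₀] at hL
  -- pointwise scaling identity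
  have hpt : ∀ x, (τ₀ * (r x * (w₀ x) ^ 2 + 4 * ((ψ x)⁻¹ ^ 2 * g.gradSq w₀ x))
        - (w₀ x) ^ 2 * Real.log ((w₀ x) ^ 2) - 4 * (w₀ x) ^ 2) * (c / s ^ 2 * (ψ x) ^ 4) =
      (τ * (r x * (w x) ^ 2 + 4 * ((ψ x)⁻¹ ^ 2 * g.gradSq w x)) - (w x) ^ 2 * Real.log ((w x) ^ 2) - 4 * (w x) ^ 2)
          * (c * (ψ x) ^ 4)
        - (τ - τ₀) * ((r x * (w x) ^ 2 + 4 * ((ψ x)⁻¹ ^ 2 * g.gradSq w x)) * (c * (ψ x) ^ 4))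
        - Real.log (s ^ 2) * (c * (w x) ^ 2 * (ψ x) ^ 4) := by
    intro x
    have hgrad : g.gradSq w₀ x = s ^ 2 * g.gradSq w x := g.gradSq_const_mul w s x
    have hlog : (s * w x) ^ 2 * Real.log ((s * w x) ^ 2) =
        s ^ 2 * ((w x) ^ 2 * Real.log ((w x) ^ 2)) + (w x) ^ 2 * (s ^ 2 * Real.log (s ^ 2)) :=
      EntropyLocalisation.sq_mul_log_sq_mul s (w x)
    simp only [hw₀] at hgrad ⊢
    rw [hgrad, hlog]
    field_simp
    ring
  -- integrability
  have hint : ∀ {F : M → ℝ}, Continuous F → Integrable F μ := fun hF ↦ EntropyLocalisation.integrable_of_continuous g hg hF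
  have hI : Integrable (fun x ↦ (τ * (r x * (w x) ^ 2 + 4 * ((ψ x)⁻¹ ^ 2 * g.gradSq w x))
      - (w x) ^ 2 * Real.log ((w x) ^ 2) - 4 * (w x) ^ 2) * (c * (ψ x) ^ 4)) μ := hint (continuous_density g hψ hψpos hr hw τ c)
  have hIQ : Integrable (fun x ↦ (r x * (w x) ^ 2 + 4 * ((ψ x)⁻¹ ^ 2 * g.gradSq w x)) * (c * (ψ x) ^ 4)) μ :=
    hint (continuous_quadDensity g hψ hψpos hr hw c)
  have hIm : Integrable (fun x ↦ c * (w x) ^ 2 * (ψ x) ^ 4) μ :=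
    hint ((continuous_const.mul (hw.continuous.pow 2)).mul (hψ.continuous.pow 4))
  -- integrate the identity
  have hE₀ : ∫ x, (τ₀ * (r x * (w₀ x) ^ 2 + 4 * ((ψ x)⁻¹ ^ 2 * g.gradSq w₀ x))
        - (w₀ x) ^ 2 * Real.log ((w₀ x) ^ 2) - 4 * (w₀ x) ^ 2) * (c / s ^ 2 * (ψ x) ^ 4) ∂μ =
      (∫ x, (τ * (r x * (w x) ^ 2 + 4 * ((ψ x)⁻¹ ^ 2 * g.gradSq w x)) - (w x) ^ 2 * Real.log ((w x) ^ 2) - 4 * (w x) ^ 2)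
          * (c * (ψ x) ^ 4) ∂μ)
        - (τ - τ₀) * (∫ x, (r x * (w x) ^ 2 + 4 * ((ψ x)⁻¹ ^ 2 * g.gradSq w x)) * (c * (ψ x) ^ 4) ∂μ)
        - Real.log (s ^ 2) * ∫ x, c * (w x) ^ 2 * (ψ x) ^ 4 ∂μ := by
    have hI4 : Integrable (fun x ↦ (τ - τ₀) * ((r x * (w x) ^ 2 + 4 * ((ψ x)⁻¹ ^ 2 * g.gradSq w x)) * (c * (ψ x) ^ 4))) μ :=
      hIQ.const_mul _
    have hI2 : Integrable (fun x ↦ (τ * (r x * (w x) ^ 2 + 4 * ((ψ x)⁻¹ ^ 2 * g.gradSq w x))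
        - (w x) ^ 2 * Real.log ((w x) ^ 2) - 4 * (w x) ^ 2) * (c * (ψ x) ^ 4)
        - (τ - τ₀) * ((r x * (w x) ^ 2 + 4 * ((ψ x)⁻¹ ^ 2 * g.gradSq w x)) * (c * (ψ x) ^ 4))) μ := hI.sub hI4
    have hI3 : Integrable (fun x ↦ Real.log (s ^ 2) * (c * (w x) ^ 2 * (ψ x) ^ 4)) μ := hIm.const_mul _
    rw [integral_congr_ae (ae_of_all _ hpt), integral_sub hI2 hI3, integral_sub hI hI4, integral_const_mul,
      integral_const_mul]
  rw [hE₀, hnorm, mul_one] at hL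
  -- `log s² = -2 log(τ/τ₀) ≥ -a (τ - τ₀)`
  have hlogs : Real.log (s ^ 2) = -(2 * Real.log (τ / τ₀)) := by
    rw [Real.log_pow, hs, Real.log_div hτ₀.ne' hτpos.ne', Real.log_div hτpos.ne' hτ₀.ne']; push_cast; ring
  have hlog_le := two_mul_log_div_le hτ₀ haτ hτ
  have hqq : (τ - τ₀) * a ≤ (τ - τ₀) * ∫ x, (r x * (w x) ^ 2 + 4 * ((ψ x)⁻¹ ^ 2 * g.gradSq w x)) * (c * (ψ x) ^ 4) ∂μ :=
    mul_le_mul_of_nonneg_left hq (sub_nonneg.mpr hτ)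
  rw [hlogs] at hL
  nlinarith [hL, hqq, hlog_le]

end Summit.SmoothPoincare4.SmoothPoincare4.Theorems

end
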